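import Literature.Analysis.FluidPDE.FluidComputer.ThresholdLevelTableA3
import HarnessLib

/-!
# Kernel run of the A = 3 level-table checker, chunks 4 … 7 (steps 100 … 199) (bp3 gen 13, layer 4)

HONEST FRAMING: low prior, high value-of-information experiment on Tao's machine paradigm; NOT a
claim that NS blows up.

Four kernel evaluations (`decide +kernel`; no `native_decide`, no extra axioms) of the checker
`runSteps` (`ThresholdLevelCheck.lean`) on 25 steps of `ThresholdLevelTableA3.stepsT` at a time, from
the entry box `Bc i` towards the next chunk's first level, returning the entry box `Bc (i+1)`
(≈ 30 s of kernel time per chunk; same scheme as `ThresholdLevelTableRun0 … 7` for A = 2).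
-/

namespace Literature.Analysis.FluidPDE.FluidComputer

namespace ThresholdLevelTableA3

set_option maxHeartbeats 10000000 in
set_option maxRecDepth 200000 in
/-- Chunk 4 of the A = 3 table run (steps 100 … 124). [folklore] -/
theorem run4 : runSteps 60 12 3 GIt RbIt Bc4 chunk4 756172642247279 = some Bc5 := by
  decide +kernel

set_option maxHeartbeats 10000000 in
set_option maxRecDepth 200000 in
/-- Chunk 5 of the A = 3 table run (steps 125 … 149). [folklore] -/
theorem run5 : runSteps 60 12 3 GIt RbIt Bc5 chunk5 901601174475490 = some Bc6 := by
  decide +kernel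

set_option maxHeartbeats 10000000 in
set_option maxRecDepth 200000 in
/-- Chunk 6 of the A = 3 table run (steps 150 … 174). [folklore] -/
theorem run6 : runSteps 60 12 3 GIt RbIt Bc6 chunk6 1074998793132426 = some Bc7 := by
  decide +kernel

set_option maxHeartbeats 10000000 in
set_option maxRecDepth 200000 in
/-- Chunk 7 of the A = 3 table run (steps 175 … 199). [folklore] -/
theorem run7 : runSteps 60 12 3 GIt RbIt Bc7 chunk7 1281744565060555 = some Bc8 := by
  decide +kernel

end ThresholdLevelTableA3

end Literature.Analysis.FluidPDE.FluidComputer
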